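import Literature.AlgebraicGeometry.Frobenioids.ArchimedeanFSM
import Literature.AlgebraicGeometry.Frobenioids.ArchimedeanRegionCalculus
import HarnessLib

/-!
# Frobenioids II, Proposition 3.4 (i): PROOF (abc-iut cell, layer L1, node `FrdII:Prop3.4(i)`, chain LC-L1-2)

Mochizuki, *The geometry of Frobenioids II: poly-Frobenioids*, Kyushu J. Math. **62** (2008)
401–460, §3, Proposition 3.4 (i) p. 29, proof p. 30 ll. 1–3 [cite: MochizukiFrdII2008, Prop 3.4 (i) p.29].
PROOF-ONLY companion of `ArchimedeanFSM.lean` (statements, seat abc-iut-L1-t6): the named statement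
`ArchFrd.Prop34_i π` ("Fiberwise-surjective morphisms of `F` project to fiberwise-surjective morphisms
of `D`", for `F = A, N, R`) is a theorem, `prop34_i_holds`.

> "Assertion (i) follows immediately from the observation that if `A ∈ Ob(F)` projects to an object
> `A_D ∈ Ob(D)`, then any morphism `B_D → A_D` in `D` lifts to a morphism `B → A` of `F`, for some
> `B ∈ Ob(F)`."

The observation (`A.exists_lift`, `N.exists_lift`, `R.exists_lift`) is proved through the base change
of angular regions (`ArchFrd.exists_pulledRegion`, seat abc-iut-L1-d7): the lift of `B_D → A_D` is the
linear isometry `(f, 1, 1)` from the pulled-back region over `B_D` (`C0.exists_lift`), which lies in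
`A` (isometric), in `N` (linear isometric) and in `R` (over the real unit through `A`'s structure arrow).
The deduction "(observation) ⇒ (i)" is the generic `Tower.propI_of_lift`. Nothing is defined here; no
statement of the paper is strengthened; no side is taken on [IUTchIII] Cor. 3.12.
-/

namespace Literature.AlgebraicGeometry.Frobenioids

open CategoryTheory
open scoped Pointwise

namespace ArchFrd

universe v u

/-! ### (i) from the lifting observation, for any tower -/

namespace Tower

variable {D : Type u} [Category.{v} D] {π : D ⥤ D0} (T : Tower π)

/-- **Prop. 3.4 (i), proof** (FrdII p. 30 ll. 1–3), generic form: if every arrow `B_D → A_D` of `D` into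
the projection of an object `A` of `F` lifts to an arrow of `F` into `A` (up to the identification of
the projection of its domain), then fiberwise-surjective morphisms of `F` project to fiberwise-surjective
morphisms of `D`. [cite: MochizukiFrdII2008, Prop 3.4 (i) p.30] -/
theorem propI_of_lift
    (hlift : ∀ (Y : T.F) {Z : D} (γ : Z ⟶ T.toD.obj Y),
      ∃ (Y' : T.F) (γ' : Y' ⟶ Y) (e : T.toD.obj Y' = Z), T.toD.map γ' = eqToHom e ≫ γ) :
    T.PropI := by
  intro X Y φ hφ Z γ
  obtain ⟨Z', γ', e, hγ'⟩ := hlift Y γ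
  obtain ⟨W, δ₁, δ₂, h⟩ := hφ γ'
  refine ⟨T.toD.obj W, T.toD.map δ₁, T.toD.map δ₂ ≫ eqToHom e, ?_⟩
  calc T.toD.map δ₁ ≫ T.toD.map φ = T.toD.map (δ₂ ≫ γ') := by rw [← Functor.map_comp, h]
    _ = (T.toD.map δ₂ ≫ eqToHom e) ≫ γ := by rw [Functor.map_comp, hγ', Category.assoc]

end Tower

/-! ### The observation at the level of `C₀`: linear isometric lifts over base changes -/

namespace C0

/-- **Prop. 3.4 (i), proof, the observation for `C₀`** (FrdII p. 30; Def. 3.1 (iv) base change): for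
`Y = (Spec K, V_K, A_K)` and `f : Spec L → Spec K` in `D₀`, the object `(Spec L, V_K|_L, A_K|_L)` maps to
`Y` by the linear isometry `(f, 1, 1)`. [cite: MochizukiFrdII2008, Prop 3.4 (i) p.30] -/
theorem exists_lift (Y : C0) {L : D0} (f : L ⟶ Y.base) :
    ∃ (A : AngularRegion ℂ) (hA : L = D0.real → A.IsIsotropic) (φ : (C0.mk L A hA) ⟶ Y),
      Base φ = f ∧ degFr φ = 1 ∧ scalar φ = 1 ∧ PreFrobenioid.IsIsometry toElem φ := by
  obtain ⟨A, hcar, htip, -, hiso⟩ := exists_pulledRegion Y f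
  have hYb : L = D0.real → Y.base = D0.real := by
    rintro rfl
    obtain ⟨K, R, hR⟩ := Y
    cases K with
    | real => rfl
    | complex => exact (D0.isEmpty_hom_real_complex.false f).elim
  have hA : L = D0.real → A.IsIsotropic := fun hL => hiso (Y.isIsotropic_of_isReal (hYb hL))
  have hm : (1 : ℂˣ) • (C0.mk L A hA).region.carrier ^ ((1 : ℕ+) : ℕ) ⊆ pullRegion Y f := by
    rw [one_smul, PNat.one_coe, pow_one]
    exact hcar.le
  refine ⟨A, hA, ⟨f, 1, 1, one_mem _, hm⟩, rfl, rfl, rfl, ?_⟩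
  rw [A0.isIsometry_iff_norm_mul_tip_pow]
  show ‖((1 : ℂˣ) : ℂ)‖ * (A.tip : ℝ) ^ ((1 : ℕ+) : ℕ) = (Y.region.tip : ℝ)
  rw [Units.val_one, norm_one, one_mul, PNat.one_coe, pow_one, htip]

end C0

/-! ### The observation for `F = A, N, R` -/

variable {D : Type u} [Category.{v} D] (π : D ⥤ D0)

/-- **Prop. 3.4 (i), proof, the observation for `F = A`**: an arrow `B_D → A_D` of `D` into the
projection of `A ∈ Ob(A)` lifts to an (isometric) arrow of `A` into `A`, from the object of `A` over
`B_D` carrying the pulled-back angular region. [cite: MochizukiFrdII2008, Prop 3.4 (i) p.30] -/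
theorem A.exists_lift (Y : A π) {Z : D} (γ : Z ⟶ (A.toBase π).obj Y) :
    ∃ (Y' : A π) (γ' : Y' ⟶ Y) (e : (A.toBase π).obj Y' = Z), (A.toBase π).map γ' = eqToHom e ≫ γ := by
  obtain ⟨⟨Y0, YD, α⟩⟩ := Y
  change Z ⟶ YD at γ
  obtain ⟨R, hR, φ₀, hb, -, -, hiso⟩ := C0.exists_lift Y0 (π.map γ ≫ α.inv)
  let X0 : C0 := ⟨π.obj Z, R, hR⟩
  let X : C π := ⟨X0, Z, Iso.refl _⟩
  have hb' : (PreFrobenioid.baseFunctor C0.toElem).map φ₀ = π.map γ ≫ α.inv := hb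
  have w : (PreFrobenioid.baseFunctor C0.toElem).map φ₀ ≫ α.hom = X.iso.hom ≫ π.map γ :=
    ((Iso.eq_comp_inv α).mp hb').trans (Category.id_comp _).symm
  let f : X ⟶ (⟨Y0, YD, α⟩ : C π) := ⟨φ₀, γ, w⟩
  have hiso' : PreFrobenioid.Div C0.toElem φ₀ = 1 := hiso
  have hf : PreFrobenioid.isometricMorphisms (C.toElem π) f := by
    change pull _ _ (PreFrobenioid.Div C0.toElem φ₀) = 1
    rw [hiso', map_one]
  exact ⟨⟨X⟩, ⟨f, hf⟩, rfl, (Category.id_comp _).symm⟩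

/-- **Prop. 3.4 (i), proof, the observation for `F = N`**: the lift of `A.exists_lift` is linear, so it
lies in the non-rigidified angloid `N = A^lin`. [cite: MochizukiFrdII2008, Prop 3.4 (i) p.30] -/
theorem N.exists_lift (Y : N π) {Z : D} (γ : Z ⟶ (N.toBase π).obj Y) :
    ∃ (Y' : N π) (γ' : Y' ⟶ Y) (e : (N.toBase π).obj Y' = Z), (N.toBase π).map γ' = eqToHom e ≫ γ := by
  obtain ⟨⟨⟨Y0, YD, α⟩⟩⟩ := Y
  change Z ⟶ YD at γ
  obtain ⟨R, hR, φ₀, hb, hd, -, hiso⟩ := C0.exists_lift Y0 (π.map γ ≫ α.inv)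
  let X0 : C0 := ⟨π.obj Z, R, hR⟩
  let X : C π := ⟨X0, Z, Iso.refl _⟩
  have hb' : (PreFrobenioid.baseFunctor C0.toElem).map φ₀ = π.map γ ≫ α.inv := hb
  have w : (PreFrobenioid.baseFunctor C0.toElem).map φ₀ ≫ α.hom = X.iso.hom ≫ π.map γ :=
    ((Iso.eq_comp_inv α).mp hb').trans (Category.id_comp _).symm
  let f : X ⟶ (⟨Y0, YD, α⟩ : C π) := ⟨φ₀, γ, w⟩
  have hiso' : PreFrobenioid.Div C0.toElem φ₀ = 1 := hiso
  have hf : PreFrobenioid.isometricMorphisms (C.toElem π) f := by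
    change pull _ _ (PreFrobenioid.Div C0.toElem φ₀) = 1
    rw [hiso', map_one]
  let f' : (⟨X⟩ : A π) ⟶ ⟨⟨Y0, YD, α⟩⟩ := ⟨f, hf⟩
  have hd' : C0.degFr φ₀ = 1 := hd
  have hlin : PreFrobenioid.linearMorphisms (A.toElem π) f' := hd'
  exact ⟨⟨⟨X⟩⟩, ⟨f', hlin⟩, rfl, (Category.id_comp _).symm⟩

/-- **Prop. 3.4 (i), proof, the observation for `F = R`**: the linear isometric lift, composed with the
structure arrow to the real unit, gives an object of the rigidified angloid `R = R₀ ×_{D₀} D` over the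
prescribed object of `D` and an arrow of `R` lifting the given one. [cite: MochizukiFrdII2008, Prop 3.4 (i) p.30] -/
theorem R.exists_lift (Y : R π) {Z : D} (γ : Z ⟶ (R.toBase π).obj Y) :
    ∃ (Y' : R π) (γ' : Y' ⟶ Y) (e : (R.toBase π).obj Y' = Z), (R.toBase π).map γ' = eqToHom e ≫ γ := by
  obtain ⟨r, YD, α⟩ := Y
  change Z ⟶ YD at γ
  obtain ⟨R', hR', φ₀, hb, hd, -, hiso⟩ := C0.exists_lift r.left.obj.obj (π.map γ ≫ α.inv)
  let X0 : C0 := ⟨π.obj Z, R', hR'⟩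
  let g : (⟨⟨X0⟩⟩ : N0) ⟶ r.left := N0.homMk φ₀ hiso hd
  let r' : R0 := Over.mk (g ≫ r.hom)
  let gOver : r' ⟶ r := Over.homMk g rfl
  let X : R π := ⟨r', Z, Iso.refl _⟩
  have hb' : R0.toD0.map gOver = π.map γ ≫ α.inv := hb
  have w : R0.toD0.map gOver ≫ α.hom = X.iso.hom ≫ π.map γ :=
    ((Iso.eq_comp_inv α).mp hb').trans (Category.id_comp _).symm
  exact ⟨X, ⟨gOver, γ, w⟩, rfl, (Category.id_comp _).symm⟩

/-- **Proposition 3.4 (i)** PROVED (FrdII p. 29): for `F = A, N, R`, "fiberwise-surjective morphisms of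
`F` project to fiberwise-surjective morphisms of `D`". [cite: MochizukiFrdII2008, Prop 3.4 (i) p.29] -/
theorem prop34_i_holds : Prop34_i π :=
  ⟨(towerA π).propI_of_lift (A.exists_lift π), (towerN π).propI_of_lift (N.exists_lift π),
    (towerR π).propI_of_lift (R.exists_lift π)⟩

end ArchFrd

end Literature.AlgebraicGeometry.Frobenioids
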